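import Summits.AtomisticToContinuum.FouriersLaw.Theorems.ClosedConeSensitivity.Negative.ZeroFrictionDictionary

/-!
# `WitnessGlue` (stmt-AtomisticToContinuum-14072) — support 1: the Gibbs weight and the closed flow

Support file for the transport-witness inequality `OddSectorIrreversibility.WitnessGlue`
(route OddSectorIrreversibility of `AtomisticToContinuum/FouriersLaw`). Bookkeeping about the
objects the glue manipulates, all sorry-free:

* `gibbsWeight ω₂ lam β γ N T` — the unnormalised Gibbs weight `μ_T = e^{-H_N/T} dq dp` exactly as it
  is spelled (`volume.withDensity …`) in the route's statements; finiteness, every power `(1+H)^k`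
  is integrable, an `L²` criterion, invariance under the momentum reversal `Θ(q,p) = (q,-p)`.
* `blockCurrent`, `window` — the block current `J_{[k₁,k₂)}` and its time window
  `w(x) = ∫_{(0,τ]} J_{[k₁,k₂)}(Φ_t x) dt` along the CLOSED flow `detFlow` (the zero-friction kernels
  are Dirac masses at `detFlow`, `ZeroFrictionDictionary`); joint measurability of the flow,
  polynomial energy bounds, square integrability, and the Fubini identity pairing a window with an
  `L²` observable.

No statement of the route is asserted here.
-/

noncomputable section

namespace Summit.AtomisticToContinuum.FouriersLaw.Theorems.OddSectorWitness

open MeasureTheory Filter Topology ProbabilityTheory Set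
open scoped NNReal ENNReal
open Literature.MathematicalPhysics.KineticTheory.HeatConduction
open Summit.AtomisticToContinuum.FouriersLaw.Theorems.ClosedConeSensitivity.Negative.ZeroFrictionDictionary

/-! ## Definitions -/

/-- The unnormalised Gibbs weight `μ_T = e^{-H_N(q,p)/T} dq dp` of the pinned chain, spelled exactly
as in the route statements (`volume.withDensity (ofReal ∘ exp(-H/T))`). [folklore] -/
def gibbsWeight (ω₂ lam β γ : ℝ) (N : ℕ) (T : ℝ) : Measure (PhaseSpace N) :=
  volume.withDensity fun x : PhaseSpace N =>
    ENNReal.ofReal (Real.exp (-((pinnedChain ω₂ lam β γ).hamiltonian N x) / T))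

/-- The block current `J_{[k₁,k₂)} = ∑_{k₁ ≤ i < k₂} j_i`, spelled as in `SubBallisticWindow`. [folklore] -/
def blockCurrent (ω₂ lam β γ : ℝ) (N k₁ k₂ : ℕ) (z : PhaseSpace N) : ℝ :=
  ∑ i : Fin N, (if k₁ ≤ i.val ∧ i.val < k₂ then (pinnedChain ω₂ lam β γ).bondCurrent N i z else 0)

/-- The time window `w(x) = ∫_{(0,τ]} J_{[k₁,k₂)}(Φ_t x) dt` of the block current along the closed
(zero-friction) flow `Φ_t = detFlow`. [folklore] -/
def window (ω₂ lam β γ : ℝ) (N k₁ k₂ : ℕ) (τ : ℝ) (x : PhaseSpace N) : ℝ :=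
  ∫ t in Ioc (0 : ℝ) τ, blockCurrent ω₂ lam β γ N k₁ k₂ (detFlow ω₂ lam β N t x)

variable {ω₂ lam β : ℝ} (hω : 0 < ω₂) (hl : 0 ≤ lam) (hβ : 0 ≤ β)
include hω hl hβ

/-! ## The Gibbs weight -/

section Weight

variable (γ : ℝ) (N : ℕ) {T : ℝ}

omit hω hl hβ in
/-- The density of the Gibbs weight is measurable. [folklore] -/
theorem measurable_gibbsDensity_ofReal (T : ℝ) :
    Measurable fun x : PhaseSpace N =>
      ENNReal.ofReal (Real.exp (-((pinnedChain ω₂ lam β γ).hamiltonian N x) / T)) := by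
  have := pinnedChain_continuous_hamiltonian ω₂ lam β γ N
  fun_prop

omit hω hl hβ in
/-- Integrability against the Gibbs weight is integrability of `e^{-H/T} · f` against Lebesgue
measure. [folklore] -/
theorem integrable_gibbsWeight_iff (T : ℝ) (f : PhaseSpace N → ℝ) :
    Integrable f (gibbsWeight ω₂ lam β γ N T) ↔
      Integrable (fun x => Real.exp (-((pinnedChain ω₂ lam β γ).hamiltonian N x) / T) * f x) := by
  unfold gibbsWeight
  rw [integrable_withDensity_iff_integrable_smul' (measurable_gibbsDensity_ofReal γ N T)
    (Eventually.of_forall fun _ => ENNReal.ofReal_lt_top)]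
  refine integrable_congr (Eventually.of_forall fun x => ?_)
  simp only [ENNReal.toReal_ofReal (Real.exp_pos _).le, smul_eq_mul]

omit hω hl hβ in
/-- Integrals against the Gibbs weight are weighted Lebesgue integrals. [folklore] -/
theorem integral_gibbsWeight (T : ℝ) (f : PhaseSpace N → ℝ) :
    ∫ x, f x ∂(gibbsWeight ω₂ lam β γ N T) =
      ∫ x, Real.exp (-((pinnedChain ω₂ lam β γ).hamiltonian N x) / T) * f x := by
  unfold gibbsWeight
  rw [integral_withDensity_eq_integral_toReal_smul (measurable_gibbsDensity_ofReal γ N T)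
    (Eventually.of_forall fun _ => ENNReal.ofReal_lt_top)]
  refine integral_congr_ae (Eventually.of_forall fun x => ?_)
  simp only [ENNReal.toReal_ofReal (Real.exp_pos _).le, smul_eq_mul]

omit hω hl hβ in
/-- `(1 + H)^k ≤ k! ϑ^{-k} e^{ϑ} · e^{ϑ H}` for `ϑ > 0`, `H ≥ 0`. [folklore] -/
theorem one_add_pow_le_exp_mul {H ϑ : ℝ} (hH : 0 ≤ H) (hϑ : 0 < ϑ) (k : ℕ) :
    (1 + H) ^ k ≤ (k.factorial / ϑ ^ k * Real.exp ϑ) * Real.exp (ϑ * H) := by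
  have h := Real.pow_div_factorial_le_exp (x := ϑ * (1 + H)) (by positivity) k
  rw [mul_add, mul_one, Real.exp_add] at h
  have hk : (0 : ℝ) < k.factorial := by exact_mod_cast k.factorial_pos
  have hϑk : 0 < ϑ ^ k := pow_pos hϑ k
  rw [div_le_iff₀ hk] at h
  have h' : ϑ ^ k * (1 + H) ^ k ≤ Real.exp ϑ * Real.exp (ϑ * H) * k.factorial := by
    rw [← mul_pow, mul_add, mul_one]
    exact h
  calc (1 + H) ^ k = (ϑ ^ k * (1 + H) ^ k) / ϑ ^ k := by field_simp
    _ ≤ (Real.exp ϑ * Real.exp (ϑ * H) * k.factorial) / ϑ ^ k := by gcongr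
    _ = (k.factorial / ϑ ^ k * Real.exp ϑ) * Real.exp (ϑ * H) := by ring

omit hω hl hβ in
/-- Rewriting `e^{ϑH} · gibbsDensity` as `e^{-H/T} · e^{ϑH}`. [folklore] -/
theorem exp_mul_gibbsDensity_eq (T ϑ : ℝ) (x : PhaseSpace N) :
    Real.exp (ϑ * (pinnedChain ω₂ lam β γ).hamiltonian N x) * (pinnedChain ω₂ lam β γ).gibbsDensity N T x =
      Real.exp (-((pinnedChain ω₂ lam β γ).hamiltonian N x) / T) *
        Real.exp (ϑ * (pinnedChain ω₂ lam β γ).hamiltonian N x) := by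
  rw [OscillatorChain.gibbsDensity, mul_comm]

/-- Every power of `1 + H` is integrable against the Gibbs weight (Gaussian confinement:
`(1+H)^k ≲ e^{H/(2T)}` and `e^{H/(2T)} e^{-H/T}` is integrable). [folklore] -/
theorem integrable_one_add_hamiltonian_pow (hT : 0 < T) (k : ℕ) :
    Integrable (fun x => (1 + (pinnedChain ω₂ lam β γ).hamiltonian N x) ^ k) (gibbsWeight ω₂ lam β γ N T) := by
  rw [integrable_gibbsWeight_iff]
  set H := (pinnedChain ω₂ lam β γ).hamiltonian N with hH
  have hϑ : 0 < 1 / (2 * T) := by positivity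
  have hϑ' : 1 / (2 * T) < 1 / T := by
    rw [one_div_lt_one_div (by positivity) hT]; linarith
  have hmaj := (pinnedChain_integrable_exp_mul_gibbsDensity hω hl hβ γ N hT hϑ').const_mul
    (k.factorial / (1 / (2 * T)) ^ k * Real.exp (1 / (2 * T)))
  have hcont : Continuous H := pinnedChain_continuous_hamiltonian ω₂ lam β γ N
  refine hmaj.mono' (by fun_prop) (Eventually.of_forall fun x => ?_)
  have hH0 : 0 ≤ H x := pinnedChain_hamiltonian_nonneg hω.le hl hβ γ N x
  rw [Real.norm_eq_abs, abs_of_nonneg (by positivity), exp_mul_gibbsDensity_eq]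
  have h1 := one_add_pow_le_exp_mul hH0 hϑ k
  have he : 0 < Real.exp (-H x / T) := Real.exp_pos _
  calc Real.exp (-H x / T) * (1 + H x) ^ k
      ≤ Real.exp (-H x / T) * ((k.factorial / (1 / (2 * T)) ^ k * Real.exp (1 / (2 * T))) *
          Real.exp (1 / (2 * T) * H x)) := mul_le_mul_of_nonneg_left h1 he.le
    _ = _ := by ring

/-- The Gibbs weight is a finite measure. [folklore] -/
theorem isFiniteMeasure_gibbsWeight (hT : 0 < T) : IsFiniteMeasure (gibbsWeight ω₂ lam β γ N T) := by
  have h := integrable_one_add_hamiltonian_pow hω hl hβ γ N hT 0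
  simp only [pow_zero] at h
  constructor
  simpa using h.lintegral_lt_top

/-- An a.e.-strongly measurable function dominated by a multiple of a power of `1 + H` is integrable
against the Gibbs weight. [folklore] -/
theorem integrable_of_abs_le_pow (hT : 0 < T) {f : PhaseSpace N → ℝ}
    (hf : AEStronglyMeasurable f (gibbsWeight ω₂ lam β γ N T)) (K : ℝ) (k : ℕ)
    (h : ∀ x, |f x| ≤ K * (1 + (pinnedChain ω₂ lam β γ).hamiltonian N x) ^ k) :
    Integrable f (gibbsWeight ω₂ lam β γ N T) := by
  refine ((integrable_one_add_hamiltonian_pow hω hl hβ γ N hT k).const_mul K).mono' hf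
    (Eventually.of_forall fun x => ?_)
  rw [Real.norm_eq_abs]
  exact h x

/-- A continuous function dominated by a multiple of a power of `1 + H` is square integrable against
the Gibbs weight. [folklore] -/
theorem memLp_two_of_abs_le_pow (hT : 0 < T) {f : PhaseSpace N → ℝ}
    (hf : AEStronglyMeasurable f (gibbsWeight ω₂ lam β γ N T)) (K : ℝ) (k : ℕ)
    (h : ∀ x, |f x| ≤ K * (1 + (pinnedChain ω₂ lam β γ).hamiltonian N x) ^ k) :
    MemLp f 2 (gibbsWeight ω₂ lam β γ N T) := by
  rw [memLp_two_iff_integrable_sq hf]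
  refine integrable_of_abs_le_pow hω hl hβ γ N hT (hf.pow 2) (K ^ 2) (2 * k) fun x => ?_
  have hH0 : 0 ≤ (pinnedChain ω₂ lam β γ).hamiltonian N x := pinnedChain_hamiltonian_nonneg hω.le hl hβ γ N x
  rw [abs_of_nonneg (sq_nonneg _), ← sq_abs, mul_comm 2 k, pow_mul, ← mul_pow]
  exact pow_le_pow_left₀ (abs_nonneg _) (h x) 2

omit hω hl hβ in
/-- The momentum reversal `Θ(q,p) = (q,-p)` preserves the Gibbs weight (`H` is even in `p`). [folklore] -/
theorem measurePreserving_momentumReversal_gibbsWeight (T : ℝ) :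
    MeasurePreserving (momentumReversal N) (gibbsWeight ω₂ lam β γ N T) (gibbsWeight ω₂ lam β γ N T) := by
  refine ⟨(momentumReversal N).measurable, ?_⟩
  unfold gibbsWeight
  set ρ := fun x : PhaseSpace N => ENNReal.ofReal (Real.exp (-((pinnedChain ω₂ lam β γ).hamiltonian N x) / T))
  have hρ : Measurable ρ := measurable_gibbsDensity_ofReal γ N T
  have hρΘ : ρ ∘ (momentumReversal N) = ρ := by
    funext x
    simp only [ρ, Function.comp_apply]
    rw [show (momentumReversal N) x = (x.1, -x.2) from rfl, OscillatorChain.hamiltonian_neg_momentum]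
  ext s hs
  rw [Measure.map_apply (momentumReversal N).measurable hs, withDensity_apply _ hs,
    withDensity_apply _ ((momentumReversal N).measurable hs)]
  have hmp := measurePreserving_momentumReversal N
  rw [← hmp.setLIntegral_comp_preimage hs hρ]
  refine setLIntegral_congr_fun ((momentumReversal N).measurable hs) (fun x _ => ?_)
  have := congrFun hρΘ x
  simpa only [Function.comp_apply] using this.symm

omit hω hl hβ in
/-- Change of variables under the momentum reversal for the Gibbs weight. [folklore] -/
theorem integral_comp_momentumReversal_gibbsWeight (T : ℝ) (g : PhaseSpace N → ℝ) :
    ∫ x, g (x.1, -x.2) ∂(gibbsWeight ω₂ lam β γ N T) = ∫ x, g x ∂(gibbsWeight ω₂ lam β γ N T) := by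
  have h := (measurePreserving_momentumReversal_gibbsWeight (ω₂ := ω₂) (lam := lam) (β := β) γ N T).integral_comp
    (momentumReversal N).measurableEmbedding g
  exact h

end Weight

/-! ## The closed flow: measurability and energy bounds -/

section Flow

variable (N : ℕ)

/-- The closed flow is continuous in time. [folklore] -/
theorem continuous_detFlow_time (x : PhaseSpace N) : Continuous fun t => detFlow ω₂ lam β N t x :=
  pinnedChain_continuous_chainFlow hω hl hβ le_rfl N x continuous_const

/-- The closed flow is jointly measurable in `(t, x)`. [folklore] -/
theorem measurable_detFlow_uncurry :
    Measurable fun p : ℝ × PhaseSpace N => detFlow ω₂ lam β N p.1 p.2 :=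
  measurable_uncurry_of_continuous_of_measurable (u := fun t x => detFlow ω₂ lam β N t x)
    (fun x => continuous_detFlow_time hω hl hβ N x) fun t => (continuous_detFlow hω hl hβ N t).measurable

/-- Energy conservation along the closed flow, all real times (the flow is clamped to the identity
for `t ≤ 0`). [folklore] -/
theorem hamiltonian_detFlow_all (γ : ℝ) (t : ℝ) (y : PhaseSpace N) :
    (pinnedChain ω₂ lam β γ).hamiltonian N (detFlow ω₂ lam β N t y) = (pinnedChain ω₂ lam β γ).hamiltonian N y := by
  rw [hamiltonian_indep_friction]
  rcases le_or_gt t 0 with ht | ht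
  · rw [detFlow_of_nonpos N ht]
  · exact hamiltonian_detFlow hω hl hβ N ht.le y

/-- Polynomial energy bound for a current transported along the closed flow:
`|j_i(Φ_t y)| ≤ N (3+β)/2 (1 + H(y))²` (energy conservation). [folklore] -/
theorem abs_bondCurrent_detFlow_le (γ : ℝ) (i : Fin N) (t : ℝ) (y : PhaseSpace N) :
    |(pinnedChain ω₂ lam β γ).bondCurrent N i (detFlow ω₂ lam β N t y)| ≤
      N * ((3 + β) / 2 * (1 + (pinnedChain ω₂ lam β γ).hamiltonian N y) ^ 2) := by
  -- adapted from Cruxes/ClosedConeSensitivity/Disproof.lean (refuter-cdisprove seat)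
  have h := pinnedChain_abs_bondCurrent_le hω.le hl hβ γ N i (detFlow ω₂ lam β N t y)
  rwa [hamiltonian_detFlow_all hω hl hβ N γ t y] at h

omit hω hl hβ in
/-- The block current is continuous. [folklore] -/
theorem continuous_blockCurrent (γ : ℝ) (k₁ k₂ : ℕ) : Continuous (blockCurrent ω₂ lam β γ N k₁ k₂) := by
  unfold blockCurrent
  refine continuous_finsetSum _ fun i _ => ?_
  split_ifs
  · exact pinnedChain_continuous_bondCurrent ω₂ lam β γ N i
  · exact continuous_const

omit hω hl hβ in
/-- The block current is dominated by the sum of the absolute bond currents. [folklore] -/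
theorem abs_blockCurrent_le (γ : ℝ) (k₁ k₂ : ℕ) (z : PhaseSpace N) :
    |blockCurrent ω₂ lam β γ N k₁ k₂ z| ≤ ∑ i : Fin N, |(pinnedChain ω₂ lam β γ).bondCurrent N i z| := by
  unfold blockCurrent
  refine (Finset.abs_sum_le_sum_abs _ _).trans (Finset.sum_le_sum fun i _ => ?_)
  split_ifs
  · exact le_rfl
  · simp

/-- Energy bound for the block current transported along the closed flow. [folklore] -/
theorem abs_blockCurrent_detFlow_le (γ : ℝ) (k₁ k₂ : ℕ) (t : ℝ) (y : PhaseSpace N) :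
    |blockCurrent ω₂ lam β γ N k₁ k₂ (detFlow ω₂ lam β N t y)| ≤
      N * (N * ((3 + β) / 2 * (1 + (pinnedChain ω₂ lam β γ).hamiltonian N y) ^ 2)) := by
  refine (abs_blockCurrent_le N γ k₁ k₂ _).trans ?_
  calc ∑ i : Fin N, |(pinnedChain ω₂ lam β γ).bondCurrent N i (detFlow ω₂ lam β N t y)|
      ≤ ∑ _i : Fin N, N * ((3 + β) / 2 * (1 + (pinnedChain ω₂ lam β γ).hamiltonian N y) ^ 2) :=
        Finset.sum_le_sum fun i _ => abs_bondCurrent_detFlow_le hω hl hβ N γ i t y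
    _ = _ := by simp

/-- The transported block current `(t, x) ↦ J_B(Φ_t x)` is jointly measurable. [folklore] -/
theorem measurable_blockCurrent_detFlow (γ : ℝ) (k₁ k₂ : ℕ) :
    Measurable fun p : ℝ × PhaseSpace N => blockCurrent ω₂ lam β γ N k₁ k₂ (detFlow ω₂ lam β N p.1 p.2) :=
  (continuous_blockCurrent N γ k₁ k₂).measurable.comp (measurable_detFlow_uncurry hω hl hβ N)

/-- The window is measurable in the initial point. [folklore] -/
theorem measurable_window (γ : ℝ) (k₁ k₂ : ℕ) (τ : ℝ) : Measurable (window ω₂ lam β γ N k₁ k₂ τ) := by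
  have hF : StronglyMeasurable fun p : PhaseSpace N × ℝ =>
      blockCurrent ω₂ lam β γ N k₁ k₂ (detFlow ω₂ lam β N p.2 p.1) :=
    ((measurable_blockCurrent_detFlow hω hl hβ N γ k₁ k₂).comp measurable_swap).stronglyMeasurable
  exact (hF.integral_prod_right' (ν := volume.restrict (Ioc (0 : ℝ) τ))).measurable

/-- The window is bounded by `τ` times the energy bound of its integrand. [folklore] -/
theorem abs_window_le (γ : ℝ) (k₁ k₂ : ℕ) {τ : ℝ} (hτ : 0 ≤ τ) (x : PhaseSpace N) :
    |window ω₂ lam β γ N k₁ k₂ τ x| ≤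
      τ * (N * (N * ((3 + β) / 2 * (1 + (pinnedChain ω₂ lam β γ).hamiltonian N x) ^ 2))) := by
  unfold window
  have h := norm_setIntegral_le_of_norm_le_const (μ := (volume : Measure ℝ)) (s := Ioc (0 : ℝ) τ)
    (f := fun t => blockCurrent ω₂ lam β γ N k₁ k₂ (detFlow ω₂ lam β N t x))
    (C := N * (N * ((3 + β) / 2 * (1 + (pinnedChain ω₂ lam β γ).hamiltonian N x) ^ 2)))
    (by rw [Real.volume_Ioc]; exact ENNReal.ofReal_lt_top) fun t ht => by
      rw [Real.norm_eq_abs]; exact abs_blockCurrent_detFlow_le hω hl hβ N γ k₁ k₂ t x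
  rw [Real.norm_eq_abs, Measure.real, Real.volume_Ioc, ENNReal.toReal_ofReal (by linarith), sub_zero] at h
  linarith [h]

/-- The window is square integrable against the Gibbs weight. [folklore] -/
theorem memLp_two_window (γ : ℝ) (k₁ k₂ : ℕ) {τ T : ℝ} (hτ : 0 ≤ τ) (hT : 0 < T) :
    MemLp (window ω₂ lam β γ N k₁ k₂ τ) 2 (gibbsWeight ω₂ lam β γ N T) :=
  memLp_two_of_abs_le_pow hω hl hβ γ N hT (measurable_window hω hl hβ N γ k₁ k₂ τ).aestronglyMeasurable
    (τ * (N * (N * ((3 + β) / 2)))) 2 fun x => by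
      have := abs_window_le hω hl hβ N γ k₁ k₂ hτ x
      nlinarith [this]

/-- The squared window is integrable against the Gibbs weight (so the Bochner integral in
`SubBallisticWindow` is an honest one). [folklore] -/
theorem integrable_window_sq (γ : ℝ) (k₁ k₂ : ℕ) {τ T : ℝ} (hτ : 0 ≤ τ) (hT : 0 < T) :
    Integrable (fun x => (window ω₂ lam β γ N k₁ k₂ τ x) ^ 2) (gibbsWeight ω₂ lam β γ N T) :=
  (memLp_two_iff_integrable_sq (measurable_window hω hl hβ N γ k₁ k₂ τ).aestronglyMeasurable).1
    (memLp_two_window hω hl hβ N γ k₁ k₂ hτ hT)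

/-! ## Fubini: pairing an `L²` observable with a window -/

/-- A jointly measurable integrand dominated by `K (1+H(x))^k`, multiplied by `v ∈ L²(μ_T)`, is
integrable on `(0,τ] × phase space`. [folklore] -/
theorem integrable_prod_of_abs_le (γ : ℝ) {T : ℝ} (hT : 0 < T) (τ : ℝ) {v : PhaseSpace N → ℝ}
    (hv : MemLp v 2 (gibbsWeight ω₂ lam β γ N T)) {G : ℝ × PhaseSpace N → ℝ} (hG : Measurable G)
    (K : ℝ) (k : ℕ)
    (hGle : ∀ t x, |G (t, x)| ≤ K * (1 + (pinnedChain ω₂ lam β γ).hamiltonian N x) ^ k) :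
    Integrable (fun p : ℝ × PhaseSpace N => v p.2 * G p)
      ((volume.restrict (Ioc (0 : ℝ) τ)).prod (gibbsWeight ω₂ lam β γ N T)) := by
  have hpow : MemLp (fun x => K * (1 + (pinnedChain ω₂ lam β γ).hamiltonian N x) ^ k) 2
      (gibbsWeight ω₂ lam β γ N T) := by
    refine memLp_two_of_abs_le_pow hω hl hβ γ N hT ?_ |K| k fun x => ?_
    · have := pinnedChain_continuous_hamiltonian ω₂ lam β γ N
      exact (Continuous.aestronglyMeasurable (by fun_prop))
    · have hH0 : 0 ≤ (pinnedChain ω₂ lam β γ).hamiltonian N x := pinnedChain_hamiltonian_nonneg hω.le hl hβ γ N x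
      rw [abs_mul, abs_of_nonneg (by positivity : (0:ℝ) ≤ (1 + (pinnedChain ω₂ lam β γ).hamiltonian N x) ^ k)]
  have hB : Integrable (fun x => ‖v x‖ * (K * (1 + (pinnedChain ω₂ lam β γ).hamiltonian N x) ^ k))
      (gibbsWeight ω₂ lam β γ N T) := hv.norm.integrable_mul hpow
  have hprod := (integrable_const (μ := volume.restrict (Ioc (0 : ℝ) τ)) (1 : ℝ)).mul_prod hB
  refine hprod.mono' (hv.aestronglyMeasurable.comp_snd.mul hG.aestronglyMeasurable)
    (Eventually.of_forall fun p => ?_)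
  rw [norm_mul, one_mul, Real.norm_eq_abs (G p)]
  refine mul_le_mul_of_nonneg_left ?_ (norm_nonneg _)
  exact hGle p.1 p.2

/-- **Fubini for windows.** For `v ∈ L²(μ_T)` and a jointly measurable transported observable `G`
with a polynomial energy bound: `∫ v(x) (∫_{(0,τ]} G(t,x) dt) dμ_T = ∫_{(0,τ]} ∫ v(x) G(t,x) dμ_T dt`,
and the inner pairing is integrable in `t`. [folklore] -/
theorem integral_mul_setIntegral_eq (γ : ℝ) {T : ℝ} (hT : 0 < T) (τ : ℝ) {v : PhaseSpace N → ℝ}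
    (hv : MemLp v 2 (gibbsWeight ω₂ lam β γ N T)) {G : ℝ × PhaseSpace N → ℝ} (hG : Measurable G)
    (K : ℝ) (k : ℕ)
    (hGle : ∀ t x, |G (t, x)| ≤ K * (1 + (pinnedChain ω₂ lam β γ).hamiltonian N x) ^ k) :
    (∫ x, v x * (∫ t in Ioc (0 : ℝ) τ, G (t, x)) ∂(gibbsWeight ω₂ lam β γ N T) =
      ∫ t in Ioc (0 : ℝ) τ, ∫ x, v x * G (t, x) ∂(gibbsWeight ω₂ lam β γ N T)) ∧
    IntegrableOn (fun t => ∫ x, v x * G (t, x) ∂(gibbsWeight ω₂ lam β γ N T)) (Ioc (0 : ℝ) τ) := by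
  haveI := isFiniteMeasure_gibbsWeight hω hl hβ γ N hT
  have hI := integrable_prod_of_abs_le hω hl hβ N γ hT τ hv hG K k hGle
  refine ⟨?_, hI.integral_prod_left⟩
  have hswap := integral_integral_swap (μ := volume.restrict (Ioc (0 : ℝ) τ))
    (ν := gibbsWeight ω₂ lam β γ N T) (f := fun t x => v x * G (t, x)) hI
  rw [hswap]
  refine integral_congr_ae (Eventually.of_forall fun x => ?_)
  simp only
  rw [← integral_const_mul]

end Flow

end Summit.AtomisticToContinuum.FouriersLaw.Theorems.OddSectorWitness
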